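import Mathlib
import Summits.Ventures.PercRepro2.Harris
import Summits.Ventures.PercRepro2.BasePrime
import Summits.Ventures.PercRepro2.LocRows
import Summits.Ventures.PercRepro2.SwRow
import Summits.Ventures.PercRepro2.SwOut
import Summits.Ventures.PercRepro2.SwAllRow
import Summits.Ventures.PercRepro2.SwOutAll
import Summits.Ventures.PercRepro2.SwOutCube
import Summits.Ventures.PercRepro2.SwOutArmFlip
import Summits.Ventures.PercRepro2.SwOutArms
import Summits.Ventures.PercRepro2.SwOutArmOrbit

/-!
# The orbit cube and its counting inequality (blind cell PercRepro2, night-4 g10, 2026-08-25;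
proofs/NIGHT4-G10.md §7, the ARM PRINCIPLE, part 4)

On the orbit of a core-free configuration (no loop at `h`) the blue edge set of the clusters of `h`
is antitone in the cube point (`blueEdges_orbitReal_anti`), the flip of the cube exchanges the red
and the blue edge sets (`blueEdges_orbitReal_flipAll`), and the conditioning `Q` pulls back to a
lower set (`orbitReal_mem_tgtU_of_le`).  With the cube principle in its edge-set form
(`card_le_of_cube_edges`, Harris on the cube as in `SwOutCube`) this gives the rigid counting
inequality on every orbit (`card_orbit_le`).
-/

namespace Summit.Ventures.PercRepro2

namespace LocRows

open Hull

variable {V : Type*} {E : Type*} [Fintype E] [DecidableEq E]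

open scoped Classical

variable {ends : E → Sym2 V}

section OrbitCube

variable {ζ : Config E} {h : V} (hc : CoreFree ends ζ h) (hloop : ∀ e, ends e ≠ s(h, h))
include hc hloop

omit [DecidableEq E] in
/-- **The blue edge set of a realisation shrinks as `ω` grows.** -/
theorem blueEdges_orbitReal_anti {ω ω' : Config (arms ends ζ h)} (hω : ω ≤ ω') :
    blueEdges ends (orbitReal ends ζ h ω') h ⊆ blueEdges ends (orbitReal ends ζ h ω) h := by
  intro e he
  rw [blueEdges, mem_redEdges, cluster_blue_orbitReal hc] at he ⊢
  obtain ⟨hblue, x, hx, y, hy, hxy⟩ := he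
  -- some end lies in `armsFalse ω'` (no loop at `h`)
  have hte' : e ∈ touches ends (armsFalse ends ζ h ω') := by
    rcases hx with rfl | hx
    · rcases hy with rfl | hy
      · exact absurd hxy (hloop e)
      · exact ⟨y, hy, x, ends_swap hxy⟩
    · exact ⟨x, hx, y, hxy⟩
  have hte : e ∈ touches ends (armsFalse ends ζ h ω) := by
    obtain ⟨z, hz, w, hzw⟩ := hte'
    exact ⟨z, armsFalse_anti hω hz, w, hzw⟩
  refine ⟨?_, x, ?_, y, ?_, hxy⟩
  · show (!orbitReal ends ζ h ω e) = true
    rw [orbitReal_apply_of_mem hte]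
    have hblue' : (!orbitReal ends ζ h ω' e) = true := hblue
    rw [orbitReal_apply_of_mem hte'] at hblue'
    exact hblue'
  · rcases hx with rfl | hx
    · exact Set.mem_insert _ _
    · exact Set.mem_insert_of_mem _ (armsFalse_anti hω hx)
  · rcases hy with rfl | hy
    · exact Set.mem_insert _ _
    · exact Set.mem_insert_of_mem _ (armsFalse_anti hω hy)

omit [DecidableEq E] hc hloop in
/-- `insert h (armsTrue ω) = hull ∖ armsFalse ω`. -/
lemma insert_armsTrue_eq (ω : Config (arms ends ζ h)) :
    insert h (armsTrue ends ζ h ω) = hull ends ζ h \ armsFalse ends ζ h ω := by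
  ext x
  simp only [Set.mem_insert_iff, Set.mem_sdiff]
  constructor
  · rintro (rfl | hT)
    · exact ⟨Or.inl (mem_cluster_self _ _ _), fun h' => (mem_hull_sdiff_of_mem_armsFalse h').2 rfl⟩
    · exact ⟨(mem_hull_sdiff_of_mem_armsTrue hT).1, fun h' => armsFalse_disjoint_armsTrue h' hT⟩
  · rintro ⟨hH, hF⟩
    by_cases hxh : x = h
    · exact Or.inl hxh
    · rcases mem_armsFalse_or_armsTrue (ω := ω) hH hxh with h' | h'
      · exact absurd h' hF
      · exact Or.inr h'

omit [DecidableEq E] in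
/-- **The flip of the cube exchanges the red and the blue edge sets.** -/
theorem blueEdges_orbitReal_flipAll (ω : Config (arms ends ζ h)) :
    blueEdges ends (orbitReal ends ζ h (flipAll ω)) h = redEdges ends (orbitReal ends ζ h ω) h := by
  ext e
  rw [blueEdges, mem_redEdges, mem_redEdges, cluster_blue_orbitReal hc, cluster_orbitReal hc,
    armsFalse_flipAll, insert_armsTrue_eq]
  -- for an edge inside `hull ∖ armsFalse ω` the two colours are opposite
  have key : e ∈ within ends (hull ends ζ h \ armsFalse ends ζ h ω) →
      (blue (orbitReal ends ζ h (flipAll ω)) e = true ↔ orbitReal ends ζ h ω e = true) := by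
    rintro ⟨x, hx, y, hy, hxy⟩
    have hte : e ∉ touches ends (armsFalse ends ζ h ω) := by
      rintro ⟨z, hz, w, hzw⟩
      rw [hxy, Sym2.eq_iff] at hzw
      rcases hzw with ⟨rfl, _⟩ | ⟨_, rfl⟩
      · exact hx.2 hz
      · exact hy.2 hz
    have hte' : e ∈ touches ends (armsFalse ends ζ h (flipAll ω)) := by
      rw [armsFalse_flipAll]
      have hx' : x ∈ insert h (armsTrue ends ζ h ω) := by rw [insert_armsTrue_eq]; exact hx
      have hy' : y ∈ insert h (armsTrue ends ζ h ω) := by rw [insert_armsTrue_eq]; exact hy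
      rcases hx' with rfl | hx'
      · rcases hy' with rfl | hy'
        · exact absurd hxy (hloop e)
        · exact ⟨y, hy', x, ends_swap hxy⟩
      · exact ⟨x, hx', y, hxy⟩
    rw [blue_apply, orbitReal_apply_of_mem hte', orbitReal_apply_of_notMem hte, Bool.not_not]
  constructor
  · rintro ⟨hb, hw⟩; exact ⟨(key hw).1 hb, hw⟩
  · rintro ⟨hr, hw⟩; exact ⟨(key hw).2 hr, hw⟩

omit [DecidableEq E] hc hloop in
/-- Flipping the arms assigned `false` by `ω` but `true` by `ω'` takes `orbitReal ω'` to
`orbitReal ω`. -/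
lemma orbitReal_eq_flip_of_le {ω ω' : Config (arms ends ζ h)} (hω : ω ≤ ω') :
    orbitReal ends ζ h ω =
      flip ends {x | ∃ P : arms ends ζ h, (ω P = false ∧ ω' P = true) ∧ x ∈ P.1}
        (orbitReal ends ζ h ω') := by
  funext e
  unfold orbitReal
  set D := {x | ∃ P : arms ends ζ h, (ω P = false ∧ ω' P = true) ∧ x ∈ P.1} with hD
  have hsplit : e ∈ touches ends (armsFalse ends ζ h ω) ↔
      e ∈ touches ends (armsFalse ends ζ h ω') ∨ e ∈ touches ends D := by
    constructor
    · rintro ⟨x, ⟨P, hP, hxP⟩, y, hxy⟩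
      cases hP' : ω' P
      · exact Or.inl ⟨x, ⟨P, hP', hxP⟩, y, hxy⟩
      · exact Or.inr ⟨x, ⟨P, ⟨hP, hP'⟩, hxP⟩, y, hxy⟩
    · rintro (⟨x, hx, y, hxy⟩ | ⟨x, ⟨P, hP, hxP⟩, y, hxy⟩)
      · exact ⟨x, armsFalse_anti hω hx, y, hxy⟩
      · exact ⟨x, ⟨P, hP.1, hxP⟩, y, hxy⟩
  have hnot : ¬ (e ∈ touches ends (armsFalse ends ζ h ω') ∧ e ∈ touches ends D) := by
    rintro ⟨h1, h2⟩
    exact not_touches_both_of_disjoint_sel (p := fun P => ω' P = false)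
      (q := fun P => ω P = false ∧ ω' P = true) (fun P hP hQ => by rw [hP] at hQ; exact absurd hQ.2 (by decide))
      h1 h2
  by_cases h1 : e ∈ touches ends (armsFalse ends ζ h ω')
  · have h2 : e ∉ touches ends D := fun h' => hnot ⟨h1, h'⟩
    rw [flip_apply_of_notMem h2, flip_apply_of_mem h1, flip_apply_of_mem (hsplit.2 (Or.inl h1))]
  · by_cases h2 : e ∈ touches ends D
    · rw [flip_apply_of_mem h2, flip_apply_of_notMem h1, flip_apply_of_mem (hsplit.2 (Or.inr h2))]
    · rw [flip_apply_of_notMem h2, flip_apply_of_notMem h1,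
        flip_apply_of_notMem (fun h' => by rcases hsplit.1 h' with h' | h' <;> contradiction)]

omit hloop in
/-- **The conditioning `Q` pulls back to a lower set of the orbit cube.** -/
theorem orbitReal_mem_tgtU_of_le {U : Set V} {ξ : Config E} {l o : V}
    (hζ : ζ ∈ outClass ends U h ξ) (hl : l ∉ U) {ω ω' : Config (arms ends ζ h)} (hω : ω ≤ ω')
    (hQ : orbitReal ends ζ h ω' ∈ tgtU ends l h {S : Set V | o ∈ S}) :
    orbitReal ends ζ h ω ∈ tgtU ends l h {S : Set V | o ∈ S} := by
  rw [orbitReal_eq_flip_of_le hω]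
  have hD : ArmClosed ends (orbitReal ends ζ h ω') h
      {x | ∃ P : arms ends ζ h, (ω P = false ∧ ω' P = true) ∧ x ∈ P.1} :=
    armClosed_of_hull_eq (hull_orbitReal hc ω') (armClosed_armsSel _)
  refine flip_mem_tgtU_of_armClosed_red (coreFree_orbitReal hc ω') hD ?_ ?_ hl hQ
  · -- the flipped arms are red in `orbitReal ω'`
    rintro x ⟨P, hP, hxP⟩
    rw [cluster_orbitReal hc]
    refine ⟨(mem_hull_sdiff_of_mem_arms P.2 hxP).1, ?_⟩
    rintro ⟨Q, hQ, hxQ⟩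
    have : Q = P := Subtype.ext (arms_eq_of_mem Q.2 P.2 hxQ hxP)
    subst this
    rw [hP.2] at hQ; exact absurd hQ (by decide)
  · rintro x ⟨P, _, hxP⟩
    exact (mem_outClass.1 hζ).2 (mem_hull_sdiff_of_mem_arms P.2 hxP).1

end OrbitCube

section CubeEdges

omit [DecidableEq E] in
/-- **The cube principle, edge-set form**: a class `C = r '' univ` of an injective realisation of a
cube on which the red edge set of `h` is increasing, the blue edge set decreasing, the flip of the
cube exchanges them, and the conditioning pulls back to a lower set, satisfies the rigid counting
inequality on `C ∩ Qs` for every up-set `𝓔` of edge sets. -/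
theorem card_le_of_cube_edges {E' : Type*} [Fintype E'] [DecidableEq E'] (r : Config E' → Config E)
    (hr : Function.Injective r) (C : Finset (Config E)) (hC : ∀ ζ, ζ ∈ C ↔ ∃ ω, r ω = ζ)
    (Qs : Set (Config E)) (hEv : IsLowerSet {ω | r ω ∈ Qs}) (h : V)
    (hT : ∀ 𝓔 : Set (Set E), IsUpperSet 𝓔 → IsUpperSet {ω | redEdges ends (r ω) h ∈ 𝓔})
    (hTp : ∀ 𝓔 : Set (Set E), IsUpperSet 𝓔 → IsLowerSet {ω | blueEdges ends (r ω) h ∈ 𝓔})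
    (hswap : ∀ ω, blueEdges ends (r (flipAll ω)) h = redEdges ends (r ω) h)
    {𝓔 : Set (Set E)} (h𝓔 : IsUpperSet 𝓔) :
    (C.filter fun ζ => ζ ∈ Qs ∧ redEdges ends ζ h ∈ 𝓔).card ≤
      (C.filter fun ζ => ζ ∈ Qs ∧ blueEdges ends ζ h ∈ 𝓔).card := by
  have e1 : (C.filter fun ζ => ζ ∈ Qs ∧ redEdges ends ζ h ∈ 𝓔) =
      (Finset.univ.filter fun ω => r ω ∈ Qs ∧ redEdges ends (r ω) h ∈ 𝓔).image r := by
    ext ζ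
    simp only [Finset.mem_filter, Finset.mem_image, Finset.mem_univ, true_and]
    constructor
    · rintro ⟨hζ, hP⟩
      obtain ⟨ω, rfl⟩ := (hC ζ).1 hζ
      exact ⟨ω, hP, rfl⟩
    · rintro ⟨ω, hP, rfl⟩
      exact ⟨(hC _).2 ⟨ω, rfl⟩, hP⟩
  have e2 : (C.filter fun ζ => ζ ∈ Qs ∧ blueEdges ends ζ h ∈ 𝓔) =
      (Finset.univ.filter fun ω => r ω ∈ Qs ∧ blueEdges ends (r ω) h ∈ 𝓔).image r := by
    ext ζ
    simp only [Finset.mem_filter, Finset.mem_image, Finset.mem_univ, true_and]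
    constructor
    · rintro ⟨hζ, hP⟩
      obtain ⟨ω, rfl⟩ := (hC ζ).1 hζ
      exact ⟨ω, hP, rfl⟩
    · rintro ⟨ω, hP, rfl⟩
      exact ⟨(hC _).2 ⟨ω, rfl⟩, hP⟩
  rw [e1, e2, Finset.card_image_of_injective _ hr, Finset.card_image_of_injective _ hr]
  have hAB : flipAll ⁻¹' {ω | blueEdges ends (r ω) h ∈ 𝓔} = {ω | redEdges ends (r ω) h ∈ 𝓔} := by
    ext ω
    simp only [Set.mem_preimage, Set.mem_setOf_eq, hswap]
  have := card_inter_le_of_cube hEv (hT 𝓔 h𝓔) (hTp 𝓔 h𝓔) hAB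
  convert this using 2 <;> ext ω <;>
    simp only [Finset.mem_filter, Finset.mem_univ, true_and, Set.mem_inter_iff, Set.mem_setOf_eq]

end CubeEdges

section OrbitIneq

variable {ζ : Config E} {h : V} (hc : CoreFree ends ζ h) (hloop : ∀ e, ends e ≠ s(h, h))
include hc hloop

variable (ends ζ h) in
/-- The orbit of `ζ` under the arm flips, as a finite set of configurations. -/
noncomputable def orbit : Finset (Config E) := Finset.univ.image (orbitReal ends ζ h)

/-- **The rigid counting inequality on an orbit.** -/
theorem card_orbit_le {U : Set V} {ξ : Config E} {l o : V} (hζ : ζ ∈ outClass ends U h ξ)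
    (hl : l ∉ U) {𝓔 : Set (Set E)} (h𝓔 : IsUpperSet 𝓔) :
    ((orbit ends ζ h).filter fun ζ' =>
        ζ' ∈ tgtU ends l h {S : Set V | o ∈ S} ∧ redEdges ends ζ' h ∈ 𝓔).card ≤
      ((orbit ends ζ h).filter fun ζ' =>
        ζ' ∈ tgtU ends l h {S : Set V | o ∈ S} ∧ blueEdges ends ζ' h ∈ 𝓔).card := by
  have key := card_le_of_cube_edges (ends := ends) (orbitReal ends ζ h) orbitReal_injective
    (orbit ends ζ h) (fun ζ' => by simp only [orbit, Finset.mem_image, Finset.mem_univ, true_and])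
    (↑(tgtU ends l h {S : Set V | o ∈ S}))
    (fun ω' ω hω hQ => orbitReal_mem_tgtU_of_le hc hζ hl hω hQ) h
    (fun 𝓔' h𝓔' ω ω' hω hω𝓔 => h𝓔' (redEdges_orbitReal_mono hc hω) hω𝓔)
    (fun 𝓔' h𝓔' ω' ω hω hω𝓔 => h𝓔' (blueEdges_orbitReal_anti hc hloop hω) hω𝓔)
    (fun ω => blueEdges_orbitReal_flipAll hc hloop ω) h𝓔
  simpa only [Finset.mem_coe] using key

end OrbitIneq



end LocRows

end Summit.Ventures.PercRepro2
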